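import Literature.Probability.LatticeModels.ReflectionPositivity
import HarnessLib

/-!
# Reflection positivity is preserved by equivariant half-local push-forwards (block averaging, coarse-graining, marginals)

Theorem-only file (no definitions, no named facts).  A measurable map `π : (V → S) → (W → S′)` between configuration spaces which
INTERTWINES two reflections, `π(σ ∘ θ) = (π σ) ∘ θ′`, and is HALF-LOCAL — the coordinates of `π σ` in the positive half `W₊` are measurable
in the coordinates of `σ` in the positive half `V₊` — carries a reflection-positive measure `μ` (FILS 1978 §2 ∕ Biskup 2009 Def. 5.2: all bounded
`V₊`-measurable observables) to a reflection-positive measure `π_*μ`: for a bounded `W₊`-measurable `F`, `F ∘ π` is a bounded `V₊`-measurable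
observable and `∫ conj F(τ∘θ′)·F(τ) d(π_*μ) = ∫ conj (F∘π)(σ∘θ)·(F∘π)(σ) dμ ≥ 0`.  This is the form in which reflection positivity passes to
BLOCK AVERAGES over reflection-symmetric blocks, to sub-lattice MARGINALS, and to coordinatewise images (FILS 1978 §2: RP is formulated for the
algebra generated by the half; Biskup 2009 Remark 5.4 ∕ Lemma 5.3: functions of half-measurable observables are half-measurable; the block-spin
renormalisation-group literature uses exactly this to keep reflection positivity along the flow).

* ★ `IsReflectionPositive.map_of_equivariant`, `IsReflectionPositiveReal.map_of_equivariant` — push-forward of RP.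
* `IsReflectionInvariant.map_of_equivariant` — push-forward of reflection invariance.
* `measurable_positiveEvents_of_coord` — the half-locality hypothesis from a coordinatewise description: if every coordinate `(π σ) w`, `w ∈ W₊`, is a
  `V₊`-measurable function of `σ`, then `π` is `positiveEvents V₊ → positiveEvents W₊` measurable.

## References

* J. Fröhlich, R. Israel, E. H. Lieb, B. Simon, Comm. Math. Phys. 62 (1978) 1–34, §2 (the algebras `𝔄_±`, Thm. 2.1). [FILS1978]
* M. Biskup, *Reflection positivity and phase transitions in lattice spin models*, LNM 1970 (2009), §5.1 Def. 5.2, Lemma 5.3, Remark 5.4. [Biskup2009]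
-/

noncomputable section

open MeasureTheory

namespace Literature.Probability.LatticeModels

section Pushforward

variable {V W S S' : Type*} [MeasurableSpace S] [MeasurableSpace S']

/-- **Half-locality from coordinates**: if each positive-half coordinate of `π σ` is measurable in the positive-half coordinates of `σ`, then `π` is
measurable from `positiveEvents V₊` to `positiveEvents W₊`. [cite: Biskup2009, §5.1 Def. 5.2 (the algebra `𝔄₊`)] -/
theorem measurable_positiveEvents_of_coord {π : (V → S) → (W → S')} {Vpos : Set V} {Wpos : Set W}
    (h : ∀ w ∈ Wpos, Measurable[positiveEvents (S := S) Vpos] fun σ => π σ w) :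
    @Measurable _ _ (positiveEvents (S := S) Vpos) (positiveEvents (S := S') Wpos) π :=
  measurable_cylinderEvents_iff.mpr fun w hw => h w hw

/-- ★ **PUSH-FORWARD OF REFLECTION POSITIVITY along an equivariant half-local map**: if `μ` is reflection positive for `(θ, V₊)`, `π` is measurable,
`π(σ∘θ) = (πσ)∘θ′`, and `π` is `positiveEvents V₊ → positiveEvents W₊` measurable, then `π_*μ` is reflection positive for `(θ′, W₊)` (all bounded
`W₊`-measurable complex observables). [cite: FILS1978, §2, Thm. 2.1] [cite: Biskup2009, §5.1 Def. 5.2, Lemma 5.3] -/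
theorem IsReflectionPositive.map_of_equivariant {μ : Measure (V → S)} {θ : V ≃ V} {Vpos : Set V} (hμ : IsReflectionPositive μ θ Vpos)
    {π : (V → S) → (W → S')} (hπ : Measurable π) {θ' : W ≃ W} {Wpos : Set W}
    (hequiv : ∀ σ, π (configReflect θ σ) = configReflect θ' (π σ))
    (hloc : @Measurable _ _ (positiveEvents (S := S) Vpos) (positiveEvents (S := S') Wpos) π) :
    IsReflectionPositive (μ.map π) θ' Wpos := by
  intro F hF hFb
  have hFm : Measurable F := hF.mono cylinderEvents_le_pi le_rfl
  have hint : AEStronglyMeasurable (fun τ : W → S' => starRingEnd ℂ (F (configReflect θ' τ)) * F τ) (μ.map π) :=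
    ((Complex.continuous_conj.measurable.comp (hFm.comp (measurable_configReflect θ'))).mul hFm).aestronglyMeasurable
  rw [integral_map hπ.aemeasurable hint]
  have hcomp : (fun σ : V → S => starRingEnd ℂ (F (configReflect θ' (π σ))) * F (π σ))
      = fun σ => starRingEnd ℂ ((F ∘ π) (configReflect θ σ)) * (F ∘ π) σ := by
    funext σ
    simp only [Function.comp, hequiv]
  rw [hcomp]
  obtain ⟨C, hC⟩ := hFb
  exact hμ (F ∘ π) (hF.comp hloc) ⟨C, fun σ => hC (π σ)⟩

/-- The real form. [cite: FILS1978, §2] [cite: Biskup2009, §5.1 Def. 5.2] -/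
theorem IsReflectionPositiveReal.map_of_equivariant {μ : Measure (V → S)} {θ : V ≃ V} {Vpos : Set V} (hμ : IsReflectionPositiveReal μ θ Vpos)
    {π : (V → S) → (W → S')} (hπ : Measurable π) {θ' : W ≃ W} {Wpos : Set W}
    (hequiv : ∀ σ, π (configReflect θ σ) = configReflect θ' (π σ))
    (hloc : @Measurable _ _ (positiveEvents (S := S) Vpos) (positiveEvents (S := S') Wpos) π) :
    IsReflectionPositiveReal (μ.map π) θ' Wpos := by
  intro F hF hFb
  have hFm : Measurable F := hF.mono cylinderEvents_le_pi le_rfl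
  have hint : AEStronglyMeasurable (fun τ : W → S' => F (configReflect θ' τ) * F τ) (μ.map π) :=
    ((hFm.comp (measurable_configReflect θ')).mul hFm).aestronglyMeasurable
  rw [integral_map hπ.aemeasurable hint]
  have hcomp : (fun σ : V → S => F (configReflect θ' (π σ)) * F (π σ)) = fun σ => (F ∘ π) (configReflect θ σ) * (F ∘ π) σ := by
    funext σ
    simp only [Function.comp, hequiv]
  rw [hcomp]
  obtain ⟨C, hC⟩ := hFb
  exact hμ (F ∘ π) (hF.comp hloc) ⟨C, fun σ => hC (π σ)⟩

/-- **Push-forward of reflection invariance** along an equivariant measurable map. [cite: FILS1978, §2] -/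
theorem IsReflectionInvariant.map_of_equivariant {μ : Measure (V → S)} {θ : V ≃ V} (hμ : IsReflectionInvariant μ θ)
    {π : (V → S) → (W → S')} (hπ : Measurable π) {θ' : W ≃ W} (hequiv : ∀ σ, π (configReflect θ σ) = configReflect θ' (π σ)) :
    IsReflectionInvariant (μ.map π) θ' := by
  unfold IsReflectionInvariant at hμ ⊢
  rw [Measure.map_map (measurable_configReflect θ') hπ]
  have hc : (configReflect (S := S') θ') ∘ π = π ∘ configReflect (S := S) θ := funext fun σ => (hequiv σ).symm
  rw [hc, ← Measure.map_map hπ (measurable_configReflect θ), hμ]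

end Pushforward

end Literature.Probability.LatticeModels
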